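import Literature.Barriers.CriticalPhenomena.PositionSpaceRGNonGibbsianExtremal
import HarnessLib

/-!
# Barrier `PositionSpaceRGNonGibbsian`, Theorem 4.3 (decimation with spacing `b ≥ 2`): the
# extremal finite-volume estimate split into PHASE SELECTION (Steps 2.1–2.2) and the PLUS PHASE
# of the alternating internal-spin system (Steps 1, 2.3–2.4, 3), with the symmetry/FKG glue proved

Fourth companion file of `Literature/Barriers/CriticalPhenomena/PositionSpaceRGNonGibbsian.lean`
on the Theorem 4.3 line (van Enter–Fernández–Sokal, J. Stat. Phys. **72** (1993) 879,
arXiv:hep-lat/9210032). The chain proved so far is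
`VEFS1993_eq413_extremal ↔ VEFS1993_eq413_spacing → VEFS1993_eq432_spacing → VEFS1993_thm43`
(`PositionSpaceRGNonGibbsianExtremal.lean`, `…Spacing.lean`): Theorem 4.3 is reduced to ONE
inequality between two completely specified finite-volume zero-field Ising expectations of the spin
at the origin, `⟨σ_0⟩^{±,+,-}_{W} - ⟨σ_0⟩^{±,-,+}_{W} ≥ δ` (image spins `ω'_alt` on the core `Λ_R`,
`±1` on the annulus `Λ_{R'} ∖ Λ_R`, `∓1` everywhere else). Here this inequality is split exactly
along the printed Step 2 of §4.3.1 (invoked verbatim for `b ≥ 3` in §4.3.2: "Steps 2 and 3 are then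
proven in a manner exactly identical to the `b = 2` case") into two named facts about the volume
`W(R') = Λ^int_{R'} ∪ {0}` (`spacingVolume`), and the glue between them is PROVED:

* `VEFS1993_screening` — **Steps 2.1–2.2** ("`μ^{±,+,σ}_{R,R'}` converges as `R' → ∞` to a Gibbs
  measure for the system `⟨R;∞;±;+⟩`"; "The system `⟨R;∞;±;+⟩` has a unique Gibbs measure"), in the
  finite-volume form in which it is used: with the core image spins alternating (either parity
  `p = ±1`) on `Λ_R` and the annulus image spins `+1`, the expectation of `σ_0` in `W(R')` with
  all-`+` exterior exceeds the one with all-`-` exterior by at most `ε` once `R'` is large — the two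
  extremal boundary conditions sandwich every Gibbs measure of `⟨R;∞;±;+⟩`, so this is implied by
  (and is the operative content of) the printed uniqueness.
* `VEFS1993_plusPhase` — **Steps 1, 2.3–2.4 and 3** ("the measure `μ_{R;∞}^{±,+}` is larger (in FKG
  sense) than all Gibbs measures for the system `⟨∞;±⟩`"; "`μ^{(+)}_{∞,±}(σ_i) ≥ c > 0`", by
  Pirogov–Sinai theory, App. B.5.3, for `b ≥ 3`; unfixing of the origin, (4.7)–(4.13)), in
  finite-volume form: with ALL image spins in `Λ_{R'}` alternating (either parity) and all-`+`
  exterior, `⟨σ_0⟩_{W(R')} ≥ c > 0` uniformly in `R'` — by FKG volume monotonicity these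
  expectations decrease in `R'` to the magnetisation of the `+` phase of the alternating
  internal-spin system at the (unfixed) origin, so this is implied by the printed positivity of
  that magnetisation.

and the PROVED assembly `VEFS1993_eq413_extremal_of_screening_plusPhase :
VEFS1993_screening → VEFS1993_plusPhase → VEFS1993_eq413_extremal` (hence `→ VEFS1993_eq413_spacing`,
`→ VEFS1993_thm43`): the `-`-annulus system of (4.27) is the spin flip of a `+`-annulus system with
the core pattern of opposite parity ("by symmetry", (4.27); `isingCorr_fixed_flip_holds`), the
`+` exterior is compared with the `-` exterior by screening, and the `+` annulus is lowered to the
alternating pattern by FKG monotonicity in the boundary condition (`isingExpect_fixed_mono`), which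
lands in the plus-phase system; the two parities add up to the gap `δ = c`.

## What the source prints (arXiv:hep-lat/9210032, §4.3.1 pp. 109–112, §4.3.2 pp. 112–113)

* (4.26)–(4.27) (p. 109): "for `J` sufficiently large, there exists `c > 0` such that for all
  `R > 0` there exists `R' > R` (depending on `R`) such that `⟨σ_i⟩^{±,+,σ}_{R,R'} ≥ ⟨σ_i⟩^{±,+,-}_{R,R'}
  ≥ c > 0` (4.26) and by symmetry `⟨σ_i⟩^{±,-,σ}_{R,R'} ≤ ⟨σ_i⟩^{±,-,+}_{R,R'} ≤ -c < 0` (4.27) … This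
  will be proven using correlation inequalities together with the uniqueness of the Gibbs measure
  for the internal-spin system with image spins set to all `+` or all `-`. … We shall prove the
  following: Step 2.1) `μ^{±,+,σ}_{R,R'}` converges as `R' → ∞` to a Gibbs measure for the system
  `⟨R;∞;±;+⟩`. Step 2.2) The system `⟨R;∞;±;+⟩` has a unique Gibbs measure, call it `μ^{±,+}_{R;∞}`.
  Step 2.3) The measure `μ^{±,+}_{R;∞}` is larger (in FKG sense) than all Gibbs measures for the
  system `⟨∞;±⟩`. Step 2.4) Let `μ^{(+)}_{∞;±}` be the `+` phase (i.e. the maximal Gibbs measure in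
  FKG sense) for the system `⟨∞;±⟩`. Then `μ^{(+)}_{∞;±}(σ_i) ≥ c > 0`. From these results we will
  then deduce (4.26)."
* Step 2.2 (p. 110): "(We only need uniqueness at low enough temperature, but in fact the Gibbs
  measure is unique at all temperatures.) … changing the image spins inside `Λ_R` amounts to a
  finite-volume perturbation of the system and hence it does not alter the number of Gibbs
  measures … First argument, proving uniqueness only at low temperature: Pirogov–Sinai theory …
  Second argument, proving uniqueness at all temperatures: … Lee–Yang theorem … (4.28)–(4.31)".
* Step 2.3 (p. 111–112): "by the FKG inequality, the finite-volume Gibbs measure for the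
  `⟨R;∞;±;+⟩` system with any (internal-spin) boundary condition is larger in FKG sense than the
  finite-volume Gibbs measure for the `⟨∞;±⟩` system with the same boundary conditions."
* Step 2.4 (p. 112) and §4.3.2 (pp. 112–113): "for the fully alternating block-spin
  configuration, the system of internal spins has only two periodic ground states … these ground
  states satisfy the Peierls condition. It follows from P–S theory that at low temperature there
  are precisely two periodic Gibbs measures, `μ₊` and `μ₋`, characterized respectively by a
  strictly positive or strictly negative magnetization. The details … Appendix B (Section B.5.3).
  Steps 2 and 3 are then proven in a manner exactly identical to the `b = 2` case."
* Step 3 (p. 112): "Finally, we can 'unfix' the spin at the origin in the same way as in the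
  2-dimensional example" (§4.1.2, (4.7)–(4.13)).

## What is formalised (namespace `Literature.Barriers.CriticalPhenomena.NonGibbs`)

* `spacingVolume d b R'` — `W(R') = Λ^int_{R'} ∪ {0}`: the sites of the cube `box d (bR')` that are
  internal (some coordinate not divisible by `b`) together with the origin; `0 ∈ W(R')`, no other
  image site `bx` lies in it.
* `signedCoreAnnulusBC d b p R R' s_ann s_out` — the boundary conditions of the systems
  `⟨R;R';p·ω'_alt;s_ann;s_out⟩`: `p · ω'_alt(x)` at the image site `bx` for `x ∈ Λ_R`, `s_ann` at
  `bx` for `x ∈ Λ_{R'} ∖ Λ_R`, `s_out` everywhere else. For `p = 1` this is the accepted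
  `coreAnnulusBC`; the spin flip of `coreAnnulusBC d b R R' s t` is the parity `p = -1` condition
  with `(-s, -t)` (`neg_coreAnnulusBC`) — the "by symmetry" of (4.27).
* Named facts (not proved): `VEFS1993_screening`, `VEFS1993_plusPhase` (above).
* PROVED: `isingExpect_spinAt_zero_fixed_neg` (flip), `signedCoreAnnulusBC_anti_core` (lowering the
  annulus), `sub_le_isingExpect_minusExterior`, and the assemblies
  `VEFS1993_eq413_extremal_of_screening_plusPhase`, `VEFS1993_eq413_spacing_of_screening_plusPhase`,
  `VEFS1993_thm43_of_screening_plusPhase`.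

What remains for `VEFS1993_eq413_spacing_holds` is `VEFS1993_screening` (a low-temperature
uniqueness / screening statement for an Ising system whose frozen image spins outside the core are
all `+`) and `VEFS1993_plusPhase` (the Pirogov–Sinai content: positive magnetisation of the `+` phase
of the internal-spin system with fully alternating image spins, App. B.5.3).
-/

noncomputable section

namespace Literature.Barriers.CriticalPhenomena.NonGibbs

open MeasureTheory Literature.Probability.LatticeModels

variable {d : ℕ}

/-! ### The volume `W(R') = Λ^int_{R'} ∪ {0}` -/

/-- **The volume `W(R') = Λ^int_{R'} ∪ {0}` of the finite-volume systems of §4.3.1 Step 2 / §4.2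
Step 2 for spacing `b`** ("the Gibbs measure for the internal-spin system in the volume
`Λ^int_{R''}` … For simplicity we shall take `R'' = R'`", together with the unfixed spin at the origin
of Step 3): the sites `y` of the cube `Λ_{R'} = box d (bR')` of the original lattice that are internal
(some coordinate of `y` is not divisible by `b`), and the origin.
[cite: VanenterFernandezSokal1993, §4.2 Step 2 and §4.1.2 Step 3] -/
def spacingVolume (d b R' : ℕ) : Finset (Site d) :=
  (box d (b * R')).filter fun y => y = 0 ∨ ¬ ∀ i, (b : ℤ) ∣ y i

/-- The origin lies in `W(R')`. [cite: VanenterFernandezSokal1993, §4.1.2 Step 3] -/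
theorem zero_mem_spacingVolume (b R' : ℕ) : (0 : Site d) ∈ spacingVolume d b R' :=
  Finset.mem_filter.2 ⟨zero_mem_box d _, Or.inl rfl⟩

/-- No image site `bx`, `x ≠ 0`, lies in `W(R')` (spacing `b ≥ 1`): the hypothesis `hW` of the
transfer lemmas of `PositionSpaceRGNonGibbsianSpacing.lean`.
[cite: VanenterFernandezSokal1993, §4.1.2 Step 0] -/
theorem image_notMem_spacingVolume {b : ℕ} (hb : 0 < b) (R' : ℕ) {x : Site d} (hx : x ≠ 0) :
    (fun i => (b : ℤ) * x i) ∉ spacingVolume d b R' := by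
  simp only [spacingVolume, Finset.mem_filter, not_and, not_or, not_not]
  intro _
  refine ⟨fun h0 => hx ?_, fun i => dvd_mul_right _ _⟩
  funext i
  have := congrFun h0 i
  simp only [Pi.zero_apply, mul_eq_zero, Int.natCast_eq_zero] at this
  exact this.resolve_left hb.ne'

/-! ### The boundary conditions `⟨R;R';p·ω'_alt;s_ann;s_out⟩` -/

/-- **The boundary conditions of the systems compared in §4.3.1 Step 2, with a parity `p` for the
core pattern.** On an image site `y = bx`: `p · ω'_alt(x)` if `x ∈ Λ_R`, the annulus value `s_ann` if
`x ∈ Λ_{R'} ∖ Λ_R`; the value `s_out` at every other site (image sites outside `Λ_{R'}` and all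
internal sites — inside `W(R')` the latter are integrated out, outside they are the internal-spin
boundary condition). `p = 1`: the systems `⟨R;R';±;s_ann;s_out⟩` of (4.26)–(4.27)
(`signedCoreAnnulusBC_one`); `p = -1`: their spin flips (`neg_coreAnnulusBC`), the core pattern
`-ω'_alt` being the alternating configuration of the other parity ("by symmetry", (4.27)).
[cite: VanenterFernandezSokal1993, §4.3.1 Step 2, eqs. (4.25)–(4.27)] -/
def signedCoreAnnulusBC (d b : ℕ) (p : ℤˣ) (R R' : ℕ) (s_ann s_out : ℤˣ) : SpinConfig (Site d) :=
  open Classical in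
  fun y =>
    if (∀ i, (b : ℤ) ∣ y i) ∧ (fun i => y i / b) ∈ box d R then p * altConfig d (fun i => y i / b)
    else if (∀ i, (b : ℤ) ∣ y i) ∧ (fun i => y i / b) ∈ box d R' then s_ann else s_out

/-- Parity `p = 1` is the accepted `coreAnnulusBC`. [cite: VanenterFernandezSokal1993, §4.3.1 Step 2] -/
@[simp] theorem signedCoreAnnulusBC_one (b R R' : ℕ) (s_ann s_out : ℤˣ) :
    signedCoreAnnulusBC d b 1 R R' s_ann s_out = coreAnnulusBC d b R R' s_ann s_out := by
  funext y
  simp only [signedCoreAnnulusBC, coreAnnulusBC, one_mul]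

/-- **"By symmetry" (4.27)**: the global spin flip of `⟨R;R';±;s_ann;s_out⟩` is the system with the
core pattern of the other parity and flipped annulus/exterior values.
[cite: VanenterFernandezSokal1993, §4.3.1 eq. (4.27)] -/
theorem neg_coreAnnulusBC (b R R' : ℕ) (s_ann s_out : ℤˣ) :
    -coreAnnulusBC d b R R' s_ann s_out = signedCoreAnnulusBC d b (-1) R R' (-s_ann) (-s_out) := by
  funext y
  simp only [Pi.neg_apply, signedCoreAnnulusBC, coreAnnulusBC]
  split_ifs <;> simp

/-- The value of `signedCoreAnnulusBC` at an image site `bx`.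
[cite: VanenterFernandezSokal1993, §4.3.1 Step 2] -/
theorem signedCoreAnnulusBC_apply_image {b : ℕ} (hb : 0 < b) (p : ℤˣ) (R R' : ℕ) (s_ann s_out : ℤˣ)
    (x : Site d) :
    signedCoreAnnulusBC d b p R R' s_ann s_out (fun i => (b : ℤ) * x i) =
      open Classical in
      if x ∈ box d R then p * altConfig d x else if x ∈ box d R' then s_ann else s_out := by
  have hb' : (b : ℤ) ≠ 0 := by exact_mod_cast hb.ne'
  have hdiv : ∀ i, (b : ℤ) ∣ (b : ℤ) * x i := fun i => dvd_mul_right _ _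
  have hquot : (fun i => (b : ℤ) * x i / b) = x := funext fun i => Int.mul_ediv_cancel_left _ hb'
  unfold signedCoreAnnulusBC
  simp only [hdiv, implies_true, true_and, hquot]

/-- The value of `signedCoreAnnulusBC` at an internal site (some coordinate not divisible by `b`)
is `s_out`. [cite: VanenterFernandezSokal1993, §4.3.1 Step 2] -/
theorem signedCoreAnnulusBC_apply_internal {b : ℕ} (p : ℤˣ) (R R' : ℕ) (s_ann s_out : ℤˣ)
    {y : Site d} (hy : ¬ ∀ i, (b : ℤ) ∣ y i) :
    signedCoreAnnulusBC d b p R R' s_ann s_out y = s_out := by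
  unfold signedCoreAnnulusBC
  simp only [hy, false_and, if_false]

/-- **Lowering the annulus (Step 2.3, FKG comparison of `⟨R;·;±;+⟩` with `⟨∞;±⟩`)**: for `R ≤ R'`,
the boundary condition with ALL image spins of `Λ_{R'}` alternating lies below the one with
alternating core `Λ_R` and `+` annulus, coordinatewise (`p · ω'_alt(x) ≤ +1` on the annulus).
[cite: VanenterFernandezSokal1993, §4.3.1 Step 2.3] -/
theorem signedCoreAnnulusBC_anti_core {b : ℕ} (p : ℤˣ) {R R' : ℕ} (hRR' : R ≤ R') (s_out : ℤˣ) :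
    signedCoreAnnulusBC d b p R' R' 1 s_out ≤ signedCoreAnnulusBC d b p R R' 1 s_out := by
  intro y
  simp only [signedCoreAnnulusBC]
  by_cases h1 : (∀ i, (b : ℤ) ∣ y i) ∧ (fun i => y i / b) ∈ box d R
  · have h1' : (∀ i, (b : ℤ) ∣ y i) ∧ (fun i => y i / b) ∈ box d R' :=
      ⟨h1.1, box_mono d hRR' h1.2⟩
    rw [if_pos h1', if_pos h1]
  · by_cases h2 : (∀ i, (b : ℤ) ∣ y i) ∧ (fun i => y i / b) ∈ box d R'
    · rw [if_pos h2, if_neg h1, if_pos h2]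
      exact intUnits_le_one _
    · simp only [if_neg h2, if_neg h1, le_refl]

/-! ### The two named facts: screening (Steps 2.1–2.2) and the plus phase (Steps 1, 2.3–2.4, 3) -/

section Facts

/-- **van Enter–Fernández–Sokal 1993, §4.3.1 Steps 2.1–2.2 (phase selection by the `+` image
spins; uniqueness for the system `⟨R;∞;±;+⟩`), finite-volume form, for decimation with spacing
`b`.** For `d ≥ 2` and `b ≥ 2` there is `J₁ = J₁(d,b)` such that for every `β > J₁`, every parity
`p = ±1` of the core pattern, every `R` and every `ε > 0` there is `R₀` with: for all `R' ≥ R₀`, in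
the volume `W(R') = Λ^int_{R'} ∪ {0}` at zero field, the expectation of `σ_0` with image spins
`p·ω'_alt` on `Λ_R`, `+1` on the annulus `Λ_{R'} ∖ Λ_R` and ALL-`+` exterior exceeds the same
expectation with ALL-`-` exterior by at most `ε`:
`⟨σ_0⟩^{p±,+,+}_{W(R')} ≤ ⟨σ_0⟩^{p±,+,-}_{W(R')} + ε`. Printed: "Step 2.1) `μ^{±,+,σ}_{R,R'}`
converges as `R' → ∞` to a Gibbs measure for the system `⟨R;∞;±;+⟩`. Step 2.2) The system
`⟨R;∞;±;+⟩` has a unique Gibbs measure" ("We only need uniqueness at low enough temperature, but in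
fact the Gibbs measure is unique at all temperatures"; proofs: Pirogov–Sinai theory with a unique
ground state, App. B.5.2, or Lee–Yang / Lebowitz–Penrose analyticity with Lebowitz' inequality,
(4.28)–(4.31); "changing the image spins inside `Λ_R` amounts to a finite-volume perturbation of the
system and hence it does not alter the number of Gibbs measures" — likewise for the unfixed spin at
the origin and for the other parity). By FKG the two extremal exteriors sandwich every boundary
condition, so the printed uniqueness gives exactly this vanishing of their difference; stated here
at low temperature only (`β > J₁`), which is all that is used. Named fact, not proved here.
[cite: VanenterFernandezSokal1993, §4.3.1 Steps 2.1–2.2 and §4.3.2] -/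
def VEFS1993_screening : Prop :=
  ∀ d b : ℕ, 2 ≤ d → 2 ≤ b → ∃ J₁ : ℝ, ∀ β : ℝ, J₁ < β → ∀ p : ℤˣ, ∀ R : ℕ, ∀ ε : ℝ, 0 < ε →
    ∃ R₀ : ℕ, ∀ R' : ℕ, R₀ ≤ R' →
      isingExpect (zdGraph d) (spacingVolume d b R') β 0
          (.fixed (signedCoreAnnulusBC d b p R R' 1 1)) (spinAt 0) ≤
        isingExpect (zdGraph d) (spacingVolume d b R') β 0
          (.fixed (signedCoreAnnulusBC d b p R R' 1 (-1))) (spinAt 0) + ε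

/-- **van Enter–Fernández–Sokal 1993, §4.3.1 Steps 1, 2.3–2.4 and 3 for decimation with spacing
`b` (the `+` phase of the internal-spin system with fully alternating image spins has strictly
positive magnetisation, also at the unfixed origin; Pirogov–Sinai theory, App. B.5.3), finite-volume
form.** For `d ≥ 2` and `b ≥ 2` there is `J₂ = J₂(d,b)` such that for every `β > J₂` there is
`c > 0` with: for every parity `p = ±1` and every `R'`, in the volume `W(R') = Λ^int_{R'} ∪ {0}` at
zero field, with image spins `p·ω'_alt` on all of `Λ_{R'}` and all-`+` exterior (image and internal
spins outside `Λ_{R'}`), `⟨σ_0⟩_{W(R')} ≥ c`. Printed: "Step 2.3) The measure `μ^{±,+}_{R;∞}` is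
larger (in FKG sense) than all Gibbs measures for the system `⟨∞;±⟩`. Step 2.4) Let `μ^{(+)}_{∞;±}`
be the `+` phase (i.e. the maximal Gibbs measure in FKG sense) for the system `⟨∞;±⟩`. Then
`μ^{(+)}_{∞;±}(σ_i) ≥ c > 0`"; §4.3.2: "for the fully alternating block-spin configuration, the
system of internal spins has only two periodic ground states … these ground states satisfy the
Peierls condition. It follows from P–S theory that at low temperature there are precisely two
periodic Gibbs measures, `μ₊` and `μ₋`, characterized respectively by a strictly positive or
strictly negative magnetization … (Section B.5.3). Steps 2 and 3 are then proven in a manner exactly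
identical to the `b = 2` case" (Step 3 = unfixing of the origin, §4.1.2 (4.7)–(4.13); for
`(d,b) = (2,2)` the Peierls constant (B.77)–(B.78) degenerates and Step 1 is §4.1.2 instead). By FKG
these finite-volume `+`-exterior expectations decrease in `R'` to the magnetisation of the `+` phase
at the origin, so the printed positivity gives this uniform bound. Named fact, not proved here.
[cite: VanenterFernandezSokal1993, §4.3.1 Steps 2.3–2.4, §4.3.2 and App. B.5.3 (B.77)–(B.79)] -/
def VEFS1993_plusPhase : Prop :=
  ∀ d b : ℕ, 2 ≤ d → 2 ≤ b → ∃ J₂ : ℝ, ∀ β : ℝ, J₂ < β → ∃ c : ℝ, 0 < c ∧ ∀ p : ℤˣ, ∀ R' : ℕ,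
    c ≤ isingExpect (zdGraph d) (spacingVolume d b R') β 0
      (.fixed (signedCoreAnnulusBC d b p R' R' 1 1)) (spinAt 0)

end Facts

/-! ### The glue: symmetry, screening, FKG -/

/-- **Spin-flip symmetry at zero field for the spin at the origin**: `⟨σ_0⟩^{-ζ}_{W;β,0} =
-⟨σ_0⟩^{ζ}_{W;β,0}` (the tree's `isingCorr_fixed_flip_holds` at `A = {0}`, `h = 0`); the "by
symmetry" of (4.27). [cite: VanenterFernandezSokal1993, §4.3.1 eq. (4.27)] -/
theorem isingExpect_spinAt_zero_fixed_neg (W : Finset (Site d)) (β : ℝ) (ζ : SpinConfig (Site d)) :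
    isingExpect (zdGraph d) W β 0 (.fixed (-ζ)) (spinAt 0) =
      -isingExpect (zdGraph d) W β 0 (.fixed ζ) (spinAt 0) := by
  have h := isingCorr_fixed_flip_holds (zdGraph d) W β 0 ζ {0}
  simp only [neg_zero, Finset.card_singleton, pow_one, neg_one_mul, isingCorr,
    spinProduct_singleton] at h
  exact h

/-- **One parity of the estimate**: if the plus-phase bound `c ≤ ⟨σ_0⟩^{p±(Λ_{R'}),+}_{W(R')}` and
the screening bound `⟨σ_0⟩^{p±,+,+}_{W(R')} ≤ ⟨σ_0⟩^{p±,+,-}_{W(R')} + ε` hold at `(p, R, R')`,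
`R ≤ R'`, `β ≥ 0`, then `c - ε ≤ ⟨σ_0⟩^{p±,+,-}_{W(R')}` — lowering the `+` annulus to the
alternating pattern by FKG monotonicity in the boundary condition (Step 2.3) in between.
[cite: VanenterFernandezSokal1993, §4.3.1 Steps 2.1–2.4] -/
theorem sub_le_isingExpect_minusExterior {b : ℕ} {β c ε : ℝ} (hβ : 0 ≤ β) {p : ℤˣ} {R R' : ℕ}
    (hRR' : R ≤ R')
    (hP : c ≤ isingExpect (zdGraph d) (spacingVolume d b R') β 0
      (.fixed (signedCoreAnnulusBC d b p R' R' 1 1)) (spinAt 0))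
    (hS : isingExpect (zdGraph d) (spacingVolume d b R') β 0
          (.fixed (signedCoreAnnulusBC d b p R R' 1 1)) (spinAt 0) ≤
        isingExpect (zdGraph d) (spacingVolume d b R') β 0
          (.fixed (signedCoreAnnulusBC d b p R R' 1 (-1))) (spinAt 0) + ε) :
    c - ε ≤ isingExpect (zdGraph d) (spacingVolume d b R') β 0
      (.fixed (signedCoreAnnulusBC d b p R R' 1 (-1))) (spinAt 0) := by
  have hmono := isingExpect_fixed_mono (zdGraph d) hβ (spacingVolume d b R') 0
    (signedCoreAnnulusBC_anti_core (d := d) (b := b) p hRR' 1) (spinAt_mono 0) (measurable_spinAt 0)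
  linarith

/-- **`VEFS1993_eq413_extremal` from screening and the plus phase (the assembly of this file).**
Threshold `J₀ = max(J₁, J₂, 0)`; gap `δ = c`. Given `R`, take `R'` beyond the screening thresholds
of both parities (at `ε = c/2`) and `W = W(R')`. The `+` side: `⟨σ_0⟩^{±,+,-}_{W} ≥ c - c/2`
(`sub_le_isingExpect_minusExterior` at `p = 1`). The `-` side: `⟨σ_0⟩^{±,-,+}_{W} =
-⟨σ_0⟩^{∓,+,-}_{W}` by the spin flip at zero field (`neg_coreAnnulusBC`,
`isingExpect_spinAt_zero_fixed_neg`), and `⟨σ_0⟩^{∓,+,-}_{W} ≥ c - c/2` is the parity `p = -1`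
instance. [cite: VanenterFernandezSokal1993, §4.3.1 Step 2 (4.26)–(4.27) and §4.3.2] -/
theorem VEFS1993_eq413_extremal_of_screening_plusPhase (hS : VEFS1993_screening)
    (hP : VEFS1993_plusPhase) : VEFS1993_eq413_extremal := by
  intro d b hd hb
  obtain ⟨J₁, hJ₁⟩ := hS d b hd hb
  obtain ⟨J₂, hJ₂⟩ := hP d b hd hb
  refine ⟨max (max J₁ J₂) 0, fun β hβ => ?_⟩
  have hβ₁ : J₁ < β := lt_of_le_of_lt ((le_max_left _ _).trans (le_max_left _ _)) hβ
  have hβ₂ : J₂ < β := lt_of_le_of_lt ((le_max_right _ _).trans (le_max_left _ _)) hβ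
  have hβ0 : 0 ≤ β := (le_max_right _ 0).trans hβ.le
  have hb0 : 0 < b := by omega
  obtain ⟨c, hc, hcP⟩ := hJ₂ β hβ₂
  refine ⟨c, hc, fun R => ?_⟩
  obtain ⟨R₁, hR₁⟩ := hJ₁ β hβ₁ 1 R (c / 2) (half_pos hc)
  obtain ⟨R₂, hR₂⟩ := hJ₁ β hβ₁ (-1) R (c / 2) (half_pos hc)
  set R' : ℕ := max (max R₁ R₂) (R + 1) with hR'def
  have hRR' : R < R' := by omega
  have h₁ : R₁ ≤ R' := by omega
  have h₂ : R₂ ≤ R' := by omega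
  refine ⟨R', hRR', spacingVolume d b R', zero_mem_spacingVolume b R',
    fun x hx => image_notMem_spacingVolume hb0 R' hx, ?_⟩
  -- the `+` side, parity `p = 1`
  have hplus : c - c / 2 ≤ isingExpect (zdGraph d) (spacingVolume d b R') β 0
      (.fixed (coreAnnulusBC d b R R' 1 (-1))) (spinAt 0) := by
    rw [← signedCoreAnnulusBC_one]
    exact sub_le_isingExpect_minusExterior hβ0 hRR'.le (hcP 1 R') (hR₁ R' h₁)
  -- the `-` side is the flip of the parity `p = -1` system
  have hneg : coreAnnulusBC d b R R' (-1) 1 = -signedCoreAnnulusBC d b (-1) R R' 1 (-1) := by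
    have := neg_coreAnnulusBC (d := d) b R R' (-1) 1
    rw [neg_neg] at this
    rw [← this, neg_neg]
  have hminus : isingExpect (zdGraph d) (spacingVolume d b R') β 0
      (.fixed (coreAnnulusBC d b R R' (-1) 1)) (spinAt 0) ≤ -(c - c / 2) := by
    rw [hneg, isingExpect_spinAt_zero_fixed_neg]
    have := sub_le_isingExpect_minusExterior hβ0 hRR'.le (hcP (-1) R') (hR₂ R' h₂)
    linarith
  linarith

/-- **`VEFS1993_eq413_spacing` from screening and the plus phase** (through the accepted FKG
reduction `VEFS1993_eq413_spacing_of_extremal`).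
[cite: VanenterFernandezSokal1993, §4.3.1 Step 2 and §4.3.2] -/
theorem VEFS1993_eq413_spacing_of_screening_plusPhase (hS : VEFS1993_screening)
    (hP : VEFS1993_plusPhase) : VEFS1993_eq413_spacing :=
  VEFS1993_eq413_spacing_of_extremal (VEFS1993_eq413_extremal_of_screening_plusPhase hS hP)

/-- **Theorem 4.3 from screening and the plus phase**: `VEFS1993_screening` (Steps 2.1–2.2) and
`VEFS1993_plusPhase` (Steps 1, 2.3–2.4, 3; Pirogov–Sinai) ⟹ `VEFS1993_eq413_extremal` (this file)
⟹ `VEFS1993_eq413_spacing` (FKG) ⟹ (4.32) ⟹ Theorem 4.3 (all proved).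
[cite: VanenterFernandezSokal1993, Theorem 4.3] -/
theorem VEFS1993_thm43_of_screening_plusPhase (hS : VEFS1993_screening) (hP : VEFS1993_plusPhase) :
    VEFS1993_thm43 :=
  VEFS1993_thm43_of_extremal (VEFS1993_eq413_extremal_of_screening_plusPhase hS hP)

end Literature.Barriers.CriticalPhenomena.NonGibbs

end
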